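import Summits.CriticalPhenomena.SAWScalingLimit.Theorems.SAWLoopFugacityFlowAvoidanceLimitExcursionRatioGreen
import Literature.Probability.LatticeModels.LatticeHarmonicMeasure

/-!
# The killed-SRW Green's function is lattice-subharmonic off its pole
— helper file 2 of stub `stub_interiorRatioLimit` (S3b-INT) of line `symplectic-fermion-anchor`
(crux `SAWLoopFugacityFlow.AvoidanceLimit`, stmt-CriticalPhenomena-10649)

The two lattice inputs of `stub_sphereRatioLimit` that are not in the tree — the uniform discrete
boundary Harnack principle (BHP) and the interior convergence (INT, reduced in helper file 1 to the
convergence (GC) of the confined Green's function) — are printed (Chelkak–Wan 2021, Chelkak–Smirnov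
2011, Chelkak 2016) for INDUCED discrete domains of `δℤ²` (walk killed at the first vertex outside),
while the tree's `Ω_δ = discreteDomainGraph D δ` and `confinedGraph D D' δ` kill the simple random walk
on EDGES (those whose closed segment leaves the closure). This file proves the elementary fact that
makes the tree's UPPER-BOUND technology for the site Laplacian (maximum principle, two-constant bound
and weak Beurling estimate of `LatticeLaplacian.lean` / `LatticeHarmonicMeasure.lean` /
`WeakBeurlingEstimate.lean`, all phrased for `IsLatticeSubharmonicOn`) applicable to these edge-killed
Green's functions, for ANY subgraph `H ≤ ℤ²` and volume `Λ`:

* `greenEntry_first_step` — the first-step (harmonicity) identity of `G = (1 − ¼A_{H|Λ})⁻¹`: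
  `G(x,v) = [x = v] + ¼ Σ_{z ∈ Λ, z ∼_H x} G(z,v)` (`x, v ∈ Λ`);
* `greenEntry_le_quarter_sum_neighbor` — hence `G(x,v) ≤ ¼ Σ_{z ∼ x in ℤ²} G(z,v)` for `x ≠ v`
  (the missing terms are `≥ 0`; off `Λ` the left side is the junk value `0`);
* `greenEntry_subharmonicOn` (registered closing theorem) — **`y ↦ greenEntry H Λ y v` is
  lattice-subharmonic on `{v}ᶜ`** (`Δ ≥ 0` for the nearest-neighbour Laplacian of `ℤ²`);
* consequences, by the tree's maximum principle and weak Beurling estimate: `greenEntry_le_of_forall_outerBoundary_le`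
  (on a finite `T ∌ v`, `G(·,v)` is bounded by its maximum over the outer boundary of `T`) and
  `greenEntry_le_add_rpow_of_cutPath` (if moreover `G(·,v) ≤ ηM` on the part of `∂T` inside the box
  `sqBox p R` and `p` is joined to the outside of that box by a lattice path avoiding `T`, then
  `G(z,v) ≤ (η + C((ρ+1)/(R+1))^β)·M` on `T ∩ sqBox p ρ`).

Sources: G. F. Lawler, *Intersections of Random Walks* (1991), §1.4–1.5 (Green's function of the
killed walk, `Δ G_A(·,y) = −δ_y`) [Lawler1991]; S. Smirnov, Ann. of Math. 172 (2010), App. B,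
Lemma B.2 (weak Beurling) [Smirnov2010]. No definitions.
-/

noncomputable section

open scoped BigOperators Topology symmDiff Classical
open Filter Finset
open Literature.Probability.RandomPlanarGeometry Literature.Probability.LatticeModels

namespace Summit.CriticalPhenomena.SAWScalingLimit.Theorems.AvoidanceLimit.Anchor

open KilledGreen

/-! ## The four neighbours and the first-step identity -/

/-- A sum over the four lattice directions `cornerUnit k` is the sum over the `ℤ²`-neighbours.
[folklore] -/
theorem sum_cornerUnit_eq_sum_neighborFinset (x : Site 2) (F : Site 2 → ℝ) :
    ∑ k : Fin 4, F (x + cornerUnit k) = ∑ z ∈ (zdGraph 2).neighborFinset x, F z := by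
  rw [sum_neighborFinset_zdGraph_two, Fin.sum_univ_four]
  have h0 : cornerUnit 0 = Pi.single 0 1 := rfl
  have h1 : cornerUnit 1 = Pi.single 1 1 := rfl
  have h2 : cornerUnit 2 = Pi.single 0 (-1) := by
    show -Pi.single 0 1 = Pi.single 0 (-1)
    rw [← Pi.single_neg]
  have h3 : cornerUnit 3 = Pi.single 1 (-1) := by
    show -Pi.single 1 1 = Pi.single 1 (-1)
    rw [← Pi.single_neg]
  rw [h0, h1, h2, h3]
  ring

/-- **First-step identity** of the killed-SRW Green's function `G = (1 − ¼A_{H|Λ})⁻¹` (`H ≤ ℤ²`):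
`G(x,v) = [x = v] + ¼ Σ_{z ∈ Λ, z ∼_H x} G(z,v)` for `x, v ∈ Λ` — i.e. `(1 − P)G = 1` read
entrywise; `y ↦ G(y,v)` is harmonic for the killed walk off the pole. [cite: Lawler1991, §1.5] -/
theorem greenEntry_first_step {H : SimpleGraph (Site 2)} (hH : H ≤ zdGraph 2) (Λ : Finset (Site 2))
    {x v : Site 2} (hx : x ∈ Λ) (hv : v ∈ Λ) :
    greenEntry H Λ x v = (if x = v then 1 else 0) +
      4⁻¹ * ∑ z ∈ Λ.filter (fun z => H.Adj x z), greenEntry H Λ z v := by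
  set M : Matrix Λ Λ ℝ := (1 : Matrix Λ Λ ℝ) - (4 : ℝ)⁻¹ • adjMat H Λ with hM
  have hmul : M * M⁻¹ = 1 := Matrix.mul_nonsing_inv M
    ((Matrix.isUnit_iff_isUnit_det _).1 (isUnit_one_sub_transition Λ hH))
  have hG : ∀ {z : Site 2} (hz : z ∈ Λ), greenEntry H Λ z v = M⁻¹ ⟨z, hz⟩ ⟨v, hv⟩ := by
    intro z hz
    rw [greenEntry, dif_pos ⟨hz, hv⟩]
  -- the `(x, v)` entry of `M * M⁻¹ = 1`
  have key := congr_fun (congr_fun hmul ⟨x, hx⟩) ⟨v, hv⟩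
  rw [Matrix.mul_apply, Matrix.one_apply] at key
  have hsplit : ∑ z : Λ, M ⟨x, hx⟩ z * M⁻¹ z ⟨v, hv⟩ =
      M⁻¹ ⟨x, hx⟩ ⟨v, hv⟩ - ∑ z : Λ, ((4 : ℝ)⁻¹ • adjMat H Λ) ⟨x, hx⟩ z * M⁻¹ z ⟨v, hv⟩ := by
    simp only [hM, Matrix.sub_apply, sub_mul, Finset.sum_sub_distrib, Matrix.one_apply, ite_mul,
      one_mul, zero_mul, Finset.sum_ite_eq, Finset.mem_univ, if_true]
  rw [hsplit] at key
  -- the transition sum as a sum over `Λ.filter (H.Adj x ·)`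
  have hsum : ∑ z : Λ, ((4 : ℝ)⁻¹ • adjMat H Λ) ⟨x, hx⟩ z * M⁻¹ z ⟨v, hv⟩ =
      4⁻¹ * ∑ z ∈ Λ.filter (fun z => H.Adj x z), greenEntry H Λ z v := by
    rw [Finset.mul_sum]
    have h1 : ∑ z ∈ Λ.filter (fun z => H.Adj x z), 4⁻¹ * greenEntry H Λ z v =
        ∑ z ∈ Λ, if H.Adj x z then 4⁻¹ * greenEntry H Λ z v else 0 := Finset.sum_filter _ _
    rw [h1, ← Finset.sum_attach Λ]
    refine Finset.sum_congr rfl fun z _ => ?_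
    rw [transition_apply]
    by_cases h : H.Adj x z.1
    · rw [if_pos h, if_pos h, hG z.2]
    · rw [if_neg h, if_neg h, zero_mul]
  rw [hsum] at key
  have hxv : (if (⟨x, hx⟩ : Λ) = ⟨v, hv⟩ then (1 : ℝ) else 0) = if x = v then 1 else 0 := by
    simp only [Subtype.mk.injEq]
  rw [hxv] at key
  rw [hG hx]
  linarith

/-- **`G(x,v) ≤ ¼ Σ_{z ∼ x in ℤ²} G(z,v)` for `x ≠ v`** (any `H ≤ ℤ²`, any volume `Λ`): the
first-step identity drops only nonnegative terms (lattice neighbours not joined to `x` in `H|_Λ`);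
for `x ∉ Λ` or `v ∉ Λ` the left side is `0`. [folklore] -/
theorem greenEntry_le_quarter_sum_neighbor {H : SimpleGraph (Site 2)} (hH : H ≤ zdGraph 2)
    (Λ : Finset (Site 2)) {x v : Site 2} (hxv : x ≠ v) :
    greenEntry H Λ x v ≤ 4⁻¹ * ∑ z ∈ (zdGraph 2).neighborFinset x, greenEntry H Λ z v := by
  have hnn : 0 ≤ 4⁻¹ * ∑ z ∈ (zdGraph 2).neighborFinset x, greenEntry H Λ z v :=
    mul_nonneg (by norm_num) (Finset.sum_nonneg fun z _ => greenEntry_nonneg hH Λ z v)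
  by_cases hx : x ∈ Λ
  · by_cases hv : v ∈ Λ
    · rw [greenEntry_first_step hH Λ hx hv, if_neg hxv, zero_add]
      refine mul_le_mul_of_nonneg_left ?_ (by norm_num)
      refine Finset.sum_le_sum_of_subset_of_nonneg (fun z hz => ?_)
        fun z _ _ => greenEntry_nonneg hH Λ z v
      rw [Finset.mem_filter] at hz
      rw [SimpleGraph.mem_neighborFinset]
      exact hH hz.2
    · rw [greenEntry_of_not H fun h => hv h.2]
      exact hnn
  · rw [greenEntry_of_not H fun h => hx h.1]
    exact hnn

/-! ## Registered closing theorem: subharmonicity off the pole -/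

/-- **Registered closing theorem of this helper file.** For every subgraph `H ≤ ℤ²`, volume `Λ`
and pole `v`, the killed-SRW Green's function `y ↦ greenEntry H Λ y v = ((1 − ¼A_{H|Λ})⁻¹)_{yv}`
(walk on `ℤ²` killed at its first step that is not an edge of `H|_Λ` — edge-killing, as for the
tree's `discreteDomainGraph` / `confinedGraph`; extended by `0` off `Λ`) is SUBHARMONIC for the
nearest-neighbour Laplacian of `ℤ²` at every site other than `v`:
`Σ_k G(y + e_k, v) − 4 G(y, v) ≥ 0`. Hence the maximum principle, the two-constant bound and the
weak Beurling estimate of the tree (`IsLatticeSubharmonicOn.le_of_forall_boundary_le`,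
`le_add_mul_latticeHM`, `le_add_rpow_of_cutPath`) apply to it on any finite `T ∌ v`.
[cite: Lawler1991, §1.5] -/
theorem greenEntry_subharmonicOn :
    ∀ (H : SimpleGraph (Site 2)), H ≤ zdGraph 2 → ∀ (Λ : Finset (Site 2)) (v : Site 2),
      IsLatticeSubharmonicOn (fun y => greenEntry H Λ y v) {v}ᶜ := by
  intro H hH Λ v x hx
  have hxv : x ≠ v := hx
  have h4 : ∑ k : Fin 4, greenEntry H Λ (x + cornerUnit k) v =
      ∑ z ∈ (zdGraph 2).neighborFinset x, greenEntry H Λ z v :=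
    sum_cornerUnit_eq_sum_neighborFinset x (fun y => greenEntry H Λ y v)
  rw [latticeLaplacian_eq, h4]
  have h := greenEntry_le_quarter_sum_neighbor hH Λ hxv
  linarith

/-! ## Consequences: maximum principle and weak Beurling for the killed Green's function -/

/-- **Maximum principle for the killed Green's function**: on a finite `T ⊆ ℤ²` not containing the
pole `v`, `G(·,v)` is bounded by its maximum over the outer vertex boundary of `T`. [folklore] -/
theorem greenEntry_le_of_forall_outerBoundary_le {H : SimpleGraph (Site 2)} (hH : H ≤ zdGraph 2)
    (Λ : Finset (Site 2)) {v : Site 2} {T : Set (Site 2)} (hT : T.Finite) (hvT : v ∉ T) {M : ℝ}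
    (hM : ∀ w ∈ latticeOuterBoundary T, greenEntry H Λ w v ≤ M) :
    ∀ z ∈ T, greenEntry H Λ z v ≤ M :=
  IsLatticeSubharmonicOn.le_of_forall_boundary_le hT
    (fun x hx => greenEntry_subharmonicOn H hH Λ v x fun h => hvT (h ▸ hx)) hM

/-- **Weak Beurling estimate for the killed Green's function.** Let `T ⊆ ℤ²` be finite with
`v ∉ T`, `G(·,v) ≤ M` on the outer boundary `∂T` and `G(·,v) ≤ ηM` on `∂T ∩ sqBox p R`, and let
`p` be joined to a site outside `sqBox p R` by a lattice path avoiding `T`. Then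
`G(z,v) ≤ (η + C((ρ+1)/(R+1))^β)·M` for `z ∈ T ∩ sqBox p ρ` (`C = beurlingConst`,
`β = beurlingExp`): the tree's `le_add_rpow_of_cutPath` applied to the subharmonic `G(·,v)/M`.
[cite: Smirnov2010, Appendix B, Lemma B.2] -/
theorem greenEntry_le_add_rpow_of_cutPath {H : SimpleGraph (Site 2)} (hH : H ≤ zdGraph 2)
    (Λ : Finset (Site 2)) {v : Site 2} {T : Set (Site 2)} (hT : T.Finite) (hvT : v ∉ T)
    {M : ℝ} (hMpos : 0 < M) (hM : ∀ w ∈ latticeOuterBoundary T, greenEntry H Λ w v ≤ M)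
    {p : Site 2} {R : ℕ} {η : ℝ} (hη0 : 0 ≤ η)
    (hη : ∀ w ∈ latticeOuterBoundary T, w ∈ WeakBeurling.sqBox p R → greenEntry H Λ w v ≤ η * M)
    {d : Site 2} (q : (zdGraph 2).Walk p d) (hd : d ∉ WeakBeurling.sqBox p R)
    (hq : ∀ z ∈ q.support, z ∉ T) {ρ : ℕ} {z : Site 2} (hzT : z ∈ T) (hz : z ∈ WeakBeurling.sqBox p ρ) :
    greenEntry H Λ z v ≤
      (η + WeakBeurling.beurlingConst * (((ρ : ℝ) + 1) / ((R : ℝ) + 1)) ^ WeakBeurling.beurlingExp) * M := by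
  -- the normalised function `h = G(·,v)/M` is subharmonic on `T`, `≤ 1` on `∂T`, `≤ η` near `p`
  set h : Site 2 → ℝ := fun y => M⁻¹ * greenEntry H Λ y v with hh_def
  have hsub : IsLatticeSubharmonicOn h T := by
    intro x hx
    rw [hh_def, latticeLaplacian_const_mul]
    exact mul_nonneg (inv_nonneg.2 hMpos.le)
      (greenEntry_subharmonicOn H hH Λ v x fun h => hvT (h ▸ hx))
  have h1 : ∀ w ∈ latticeOuterBoundary T, h w ≤ 1 := fun w hw => by
    rw [hh_def]
    show M⁻¹ * greenEntry H Λ w v ≤ 1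
    rw [inv_mul_le_iff₀ hMpos, mul_one]
    exact hM w hw
  have h2 : ∀ w ∈ latticeOuterBoundary T, w ∈ WeakBeurling.sqBox p R → h w ≤ η := fun w hw hwR => by
    rw [hh_def]
    show M⁻¹ * greenEntry H Λ w v ≤ η
    rw [inv_mul_le_iff₀ hMpos, mul_comm]
    exact hη w hw hwR
  have key := le_add_rpow_of_cutPath hT hsub h1 hη0 h2 q hd hq hzT hz
  have hkey : M⁻¹ * greenEntry H Λ z v ≤
      η + WeakBeurling.beurlingConst * (((ρ : ℝ) + 1) / ((R : ℝ) + 1)) ^ WeakBeurling.beurlingExp := key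
  rw [inv_mul_le_iff₀ hMpos] at hkey
  linarith [hkey]

end Summit.CriticalPhenomena.SAWScalingLimit.Theorems.AvoidanceLimit.Anchor

end
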